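import Literature.IUT.HodgeArakelov.SplittingMonoidValues
import Literature.IUT.HodgeArakelov.GaussianMonoidsGood

/-!
# [IUTchII] Cor 3.5 (iii) / [IUTchIII] Prop 3.5 (ii)(c): the tuple-level splitting monoid `μ_{2l} · ξ^ℕ` of a
# Gaussian monoid, concretely (values)

Owner companion (abc-iut cell, layer L6; abc-iut-L6-t2; no re-typing of landed modules). S. Mochizuki,
*Inter-universal Teichmüller theory II*, kurims Dec-2020 manuscript:

* Cor 3.5 (ii) p. 94: for a value-profile `ξ ∈ θ^{F_l^⋇}_env := ∏_{|t| ∈ F_l^⋇} θ^{|t|}_env` the Gaussian monoid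
  `Ψ_ξ(M^Θ_*) := Ψ^×_cns(M^Θ_*)_{⟨F_l^⋇⟩} · ξ^ℕ ⊆ ∏_{|t| ∈ F_l^⋇} Ψ_cns(M^Θ_*)_{|t|}` — DIAGONAL units (the
  diagonal submonoid `(−)_{⟨F_l^⋇⟩}`) times the ℕ-powers of ONE value-profile `ξ` (typed as `gaussianMonoid ξ =
  unitDiagonal ⊔ powers ξ` in `BadPrimeGaussianMonoids.lean`); `Ψ_gau(M^Θ_*) := {Ψ_ξ(M^Θ_*)}_ξ` is the
  COLLECTION over all `(2l)^{l⋇}` value-profiles; Cor 3.5 (iii) p. 95: "a splitting up to torsion of each of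
  the Gaussian monoids `Ψ_ξ = Ψ^×_{⟨F_l^⋇⟩} · ξ^ℕ`";
* Rmk 2.5.1 (i)/(iii) pp. 72–73: each component of `ξ` is an element `ζ_j · q_v^{j²}` of the `μ_{2l}`-orbit
  `θ^j`, and "the various `μ_{2l}`-multiple indeterminacies … for various `j` … are independent", i.e. the
  `ζ_j` of a value-profile are COMPONENTWISE (not synchronized);
* *III*, Prop 3.5 (ii) (c) p. 105 (for the consumer's convenience): `Ψ^⊥_{F_LGP}(−)_v ⊆ Ψ_{F_LGP}(−)_v`, "the
  submonoids corresponding to these splittings [cf. the submonoids `O^⊥(−) ⊆ O^▷(−)` …] … the subgroup of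
  units of `Ψ^⊥` consists of the `2l`-torsion subgroup of `Ψ`" — and the units of `Ψ = Ψ_ξ` are the DIAGONAL
  units, so this torsion part is the DIAGONAL `μ_{2l}`.

Accordingly this file defines, for any commutative monoid `K` (e.g. `K_v`), index type `ι` and tuple
`ξ : ι → K`:

* `diagonalRoots K ι 2l ⊆ (ι → K)` — the diagonal image of `μ_{2l}(K)` (= the `2l`-torsion of the diagonal
  units `unitDiagonal`);
* `gaussianSplittingMonoid K 2l ξ := diagonalRoots ⊔ powers ξ` — **the splitting monoid `μ_{2l}^{diag} · ξ^ℕ` of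
  the Gaussian monoid `Ψ_ξ`**: elements `x = (ω · ξ_i^n)_i` with ONE `ω ∈ μ_{2l}(K)` (diagonal) and ONE `n ∈ ℕ`
  (diagonal exponent) — `mem_gaussianSplittingMonoid_iff`;
* `valueProfileOf q e ζ := (ζ_i · q^{e i})_i` — the value-profile with exponent map `e` (take `e j = j²`) and
  COMPONENTWISE torsion `ζ : ι → μ_{2l}(K)` (fixed once `ξ` is chosen);
* the relations: `gaussianSplittingMonoid ≤ gaussianMonoid ξ` (Cor 3.5's `Ψ_ξ`), each component of an element
  lies in the one-label splitting monoid `μ_{2l} · q^{e i · ℕ}` (`OPerp`, resp. `splittingMonoidAt` when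
  `e i = j²`), `2l`-th powers kill the torsion (`pow_twoL_mem_powers`: `x^{2l} ∈ (ξ^{2l})^ℕ`, the content of
  "`Ψ_{2l·ξ}` is independent of `ξ`"), and functoriality along any monoid hom `K →* R` applied componentwise
  (push into `∏_j 𝓘^ℚ(…)`-type carriers).

Claim key `Mochizuki2012` DISPUTED (D-0012): elementary monoid algebra over interfaces; nothing here asserts a
disputed claim or takes a side on [IUTchIII] Cor 3.12.
-/

namespace Literature.IUT.HodgeArakelov

universe u v w

section Tuple

variable (K : Type u) [CommMonoid K] (ι : Type v)

/-- The DIAGONAL image of `μ_{2l}(K)` in `∏_{i ∈ ι} K`: tuples `(ω, ω, …, ω)` with `ω^{2l} = 1` — the `2l`-torsion of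
the diagonal units `Ψ^×_{⟨F_l^⋇⟩}` ([IUTchII] Cor 3.5 (ii) p. 94; [IUTchIII] Prop 3.5 (ii)(c) p. 105 "the subgroup
of units of `Ψ^⊥` consists of the `2l`-torsion subgroup of `Ψ`"). [cite: Mochizuki2012, Cor 3.5 (ii) p.94] -/
def diagonalRoots (twoL : ℕ) : Submonoid (ι → K) :=
  ((rootsOfUnity twoL K).toSubmonoid.map (Units.coeHom K)).map (diagonalEmbedding ι K)

variable {K ι}

/-- Membership in the diagonal roots: `x = (ω, …, ω)` with `ω ∈ μ_{2l}(K)`. [cite: Mochizuki2012, Cor 3.5 (ii) p.94] -/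
theorem mem_diagonalRoots_iff (twoL : ℕ) (x : ι → K) :
    x ∈ diagonalRoots K ι twoL ↔ ∃ ω : Kˣ, ω ∈ rootsOfUnity twoL K ∧ x = fun _ => (ω : K) := by
  unfold diagonalRoots
  simp only [Submonoid.mem_map, Subgroup.mem_toSubmonoid, Units.coeHom_apply, exists_exists_and_eq_and]
  constructor
  · rintro ⟨ω, hω, rfl⟩; exact ⟨ω, hω, rfl⟩
  · rintro ⟨ω, hω, rfl⟩; exact ⟨ω, hω, rfl⟩

/-- The diagonal roots are diagonal units (`≤ unitDiagonal`, Cor 3.5's `Ψ^×_{⟨F_l^⋇⟩}`). [cite: Mochizuki2012, Cor 3.5 (ii) p.94] -/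
theorem diagonalRoots_le_unitDiagonal (twoL : ℕ) : diagonalRoots K ι twoL ≤ unitDiagonal ι K := by
  intro x hx
  obtain ⟨ω, -, rfl⟩ := (mem_diagonalRoots_iff twoL x).mp hx
  exact (mem_unitDiagonal _).mpr ⟨ω, rfl⟩

variable (K) in
/-- **The splitting monoid `μ_{2l}^{diag} · ξ^ℕ ⊆ ∏_ι K` of the Gaussian monoid `Ψ_ξ`** ([IUTchII] Cor 3.5 (iii) p. 95
"a splitting up to torsion of each of the Gaussian monoids `Ψ_ξ = Ψ^×_{⟨F_l^⋇⟩} · ξ^ℕ`"; = `Ψ^⊥` of [IUTchIII] Prop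
3.5 (ii)(c) read on values): generated by the DIAGONAL `2l`-torsion and by the single tuple `ξ`.
[cite: Mochizuki2012, Cor 3.5 (iii) p.95] -/
def gaussianSplittingMonoid (twoL : ℕ) (ξ : ι → K) : Submonoid (ι → K) :=
  diagonalRoots K ι twoL ⊔ Submonoid.powers ξ

/-- **Membership**: `x ∈ μ_{2l}^{diag} · ξ^ℕ` iff `x = (ω · ξ_i^n)_i` for ONE `ω ∈ μ_{2l}(K)` (diagonal torsion) and
ONE exponent `n ∈ ℕ` (diagonal exponent). [cite: Mochizuki2012, Cor 3.5 (iii) p.95] -/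
theorem mem_gaussianSplittingMonoid_iff (twoL : ℕ) (ξ x : ι → K) :
    x ∈ gaussianSplittingMonoid K twoL ξ ↔
      ∃ ω : Kˣ, ω ∈ rootsOfUnity twoL K ∧ ∃ n : ℕ, x = fun i => (ω : K) * ξ i ^ n := by
  unfold gaussianSplittingMonoid
  rw [Submonoid.mem_sup]
  constructor
  · rintro ⟨a, ha, b, hb, rfl⟩
    obtain ⟨ω, hω, rfl⟩ := (mem_diagonalRoots_iff twoL a).mp ha
    obtain ⟨n, rfl⟩ := hb
    exact ⟨ω, hω, n, funext fun i => by simp [Pi.mul_apply, Pi.pow_apply]⟩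
  · rintro ⟨ω, hω, n, rfl⟩
    refine ⟨fun _ => (ω : K), (mem_diagonalRoots_iff twoL _).mpr ⟨ω, hω, rfl⟩, ξ ^ n, ⟨n, rfl⟩, ?_⟩
    funext i
    simp [Pi.mul_apply, Pi.pow_apply]

/-- `ξ^n ∈ μ_{2l}^{diag} · ξ^ℕ`. [cite: Mochizuki2012, Cor 3.5 (iii) p.95] -/
theorem pow_mem_gaussianSplittingMonoid (twoL : ℕ) (ξ : ι → K) (n : ℕ) :
    ξ ^ n ∈ gaussianSplittingMonoid K twoL ξ :=
  Submonoid.mem_sup_right ⟨n, rfl⟩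

/-- The splitting monoid lies in the Gaussian monoid `Ψ_ξ = Ψ^×_{⟨F_l^⋇⟩} · ξ^ℕ` of Cor 3.5 (ii) (`gaussianMonoid`).
[cite: Mochizuki2012, Cor 3.5 (ii) p.94] -/
theorem gaussianSplittingMonoid_le_gaussianMonoid (twoL : ℕ) (ξ : ι → K) :
    gaussianSplittingMonoid K twoL ξ ≤ gaussianMonoid ξ :=
  sup_le_sup_right (diagonalRoots_le_unitDiagonal twoL) _

/-- **`2l`-th powers kill the torsion** (the computation behind Cor 3.5 (ii) p. 95 "`Ψ_{2l·ξ}` … is independent of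
the value-profile `ξ`"): for `x ∈ μ_{2l}^{diag} · ξ^ℕ`, `x^{2l}` is a power of `ξ^{2l}`. [cite: Mochizuki2012, Cor 3.5 (ii) p.95] -/
theorem pow_twoL_mem_powers {twoL : ℕ} {ξ x : ι → K} (hx : x ∈ gaussianSplittingMonoid K twoL ξ) :
    x ^ twoL ∈ Submonoid.powers (ξ ^ twoL) := by
  obtain ⟨ω, hω, n, rfl⟩ := (mem_gaussianSplittingMonoid_iff twoL ξ x).mp hx
  rw [mem_rootsOfUnity] at hω
  refine ⟨n, ?_⟩
  funext i
  simp only [Pi.pow_apply, mul_pow, ← Units.val_pow_eq_pow_val, hω, Units.val_one, one_mul]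
  rw [← pow_mul, ← pow_mul, mul_comm]

/-- **Componentwise reading**: the `i`-th component of an element of `μ_{2l}^{diag} · ξ^ℕ` lies in the one-label
monoid `μ_{2l} · ξ_i^ℕ` (`OPerp K 2l (powers ξ_i)`, [IUTchII] Def 4.9 (ii)). [cite: Mochizuki2012, Def 4.9 (ii) p.155] -/
theorem apply_mem_OPerp {twoL : ℕ} {ξ x : ι → K} (hx : x ∈ gaussianSplittingMonoid K twoL ξ) (i : ι) :
    x i ∈ OPerp K twoL (Submonoid.powers (ξ i)) := by
  obtain ⟨ω, hω, n, rfl⟩ := (mem_gaussianSplittingMonoid_iff twoL ξ x).mp hx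
  exact Submonoid.mul_mem _ (rootsOfUnity_mem_OPerp K twoL _ ω hω) (splitting_le_OPerp K twoL _ ⟨n, rfl⟩)

/-- **Functoriality**: a monoid hom `f : K → R` applied componentwise carries `μ_{2l}^{diag} · ξ^ℕ` into
`μ_{2l}^{diag} · (f ∘ ξ)^ℕ` — so the value monoid may be pushed into any product of rings receiving `K_v` (the
carriers `∏_j 𝓘^ℚ(…)` of [IUTchIII] Prop 3.4 (ii)/3.5 (ii)). [cite: Mochizuki2012, Cor 3.5 (iii) p.95] -/
theorem map_gaussianSplittingMonoid_le {R : Type w} [CommMonoid R] (f : K →* R) (twoL : ℕ) (ξ : ι → K) :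
    (gaussianSplittingMonoid K twoL ξ).map (MonoidHom.compLeft f ι) ≤
      gaussianSplittingMonoid R twoL (f ∘ ξ) := by
  rintro _ ⟨x, hx, rfl⟩
  rw [SetLike.mem_coe, mem_gaussianSplittingMonoid_iff] at hx
  obtain ⟨ω, hω, n, rfl⟩ := hx
  rw [mem_gaussianSplittingMonoid_iff]
  refine ⟨Units.map f ω, ?_, n, ?_⟩
  · rw [mem_rootsOfUnity] at hω ⊢
    rw [← map_pow, hω, map_one]
  · funext i
    simp [MonoidHom.compLeft, map_mul, map_pow]

/-- **"Acts multiplicatively" at the tuple level**: a subset `M ⊆ ∏_ι K` stable under multiplication by `ξ` and by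
the diagonal `μ_{2l}` is stable under the whole splitting monoid (the elementary closure fact behind
[IUTchIII] Prop 3.5 (ii)(c) "the actions … of the various monoids `Ψ^⊥_{F_LGP}` on … `𝓘^ℚ(…)`").
[cite: Mochizuki2012, Cor 3.5 (iii) p.95] -/
theorem gaussianSplittingMonoid_mul_mem {twoL : ℕ} {ξ : ι → K} {M : Set (ι → K)}
    (hξ : ∀ m ∈ M, ξ * m ∈ M)
    (hμ : ∀ ω : Kˣ, ω ∈ rootsOfUnity twoL K → ∀ m ∈ M, (fun _ => (ω : K)) * m ∈ M)
    {x : ι → K} (hx : x ∈ gaussianSplittingMonoid K twoL ξ) {m : ι → K} (hm : m ∈ M) : x * m ∈ M := by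
  obtain ⟨ω, hω, n, rfl⟩ := (mem_gaussianSplittingMonoid_iff twoL ξ x).mp hx
  have hpow : ∀ k : ℕ, ∀ m ∈ M, ξ ^ k * m ∈ M := by
    intro k
    induction k with
    | zero => intro m hm; simpa using hm
    | succ k ih =>
      intro m hm
      rw [pow_succ, mul_assoc]
      exact ih _ (hξ m hm)
  have : (fun i => (ω : K) * ξ i ^ n) = (fun _ => (ω : K)) * ξ ^ n := by
    funext i; simp [Pi.mul_apply, Pi.pow_apply]
  rw [this, mul_assoc]
  exact hμ ω hω _ (hpow n m hm)

end Tuple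

/-! ### Value-profiles from `q`, an exponent map and componentwise torsion -/

section Profile

variable {K : Type u} [CommMonoid K] {ι : Type v}

/-- **A value-profile from `q`**: `ξ = (ζ_i · q^{e i})_i` for an exponent map `e : ι → ℕ` (take `e j = j²`,
[IUTchII] Rmk 2.5.1 (i) "`q_v^{j²}`") and COMPONENTWISE torsion `ζ : ι → K^×` (the independent
`μ_{2l}`-indeterminacies of Rmk 2.5.1 (iii), fixed by the choice of the profile, Cor 3.5 (ii) p. 94).
[cite: Mochizuki2012, Cor 3.5 (ii) p.94] -/
def valueProfileOf (q : K) (e : ι → ℕ) (ζ : ι → Kˣ) : ι → K := fun i => (ζ i : K) * q ^ e i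

/-- Components of the profile. [cite: Mochizuki2012, Cor 3.5 (ii) p.94] -/
@[simp] theorem valueProfileOf_apply (q : K) (e : ι → ℕ) (ζ : ι → Kˣ) (i : ι) :
    valueProfileOf q e ζ i = (ζ i : K) * q ^ e i := rfl

/-- **Componentwise reading against the one-label value monoid**: for the profile `(ζ_i · q^{e i})_i` with
`ζ_i ∈ μ_{2l}`, the `i`-th component of every element of `μ_{2l}^{diag} · ξ^ℕ` lies in `μ_{2l} · q^{e i · ℕ}`
(`OPerp K 2l (powers (q^{e i}))`, Def 4.9 (ii)). [cite: Mochizuki2012, Def 4.9 (ii) p.155] -/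
theorem apply_mem_OPerp_pow {twoL : ℕ} {q : K} {e : ι → ℕ} {ζ : ι → Kˣ} (hζ : ∀ i, ζ i ∈ rootsOfUnity twoL K)
    {x : ι → K} (hx : x ∈ gaussianSplittingMonoid K twoL (valueProfileOf q e ζ)) (i : ι) :
    x i ∈ OPerp K twoL (Submonoid.powers (q ^ e i)) := by
  obtain ⟨ω, hω, n, rfl⟩ := (mem_gaussianSplittingMonoid_iff twoL _ x).mp hx
  simp only [valueProfileOf_apply, mul_pow]
  rw [← mul_assoc, ← Units.val_pow_eq_pow_val, ← Units.val_mul]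
  refine Submonoid.mul_mem _ (rootsOfUnity_mem_OPerp K twoL _ (ω * ζ i ^ n) ?_)
    (splitting_le_OPerp K twoL _ ⟨n, rfl⟩)
  exact Subgroup.mul_mem _ hω (Subgroup.pow_mem _ (hζ i) n)

/-- The same at the square exponents `e j = j²` (the label `j = i + 1` of `F_l^⋇`): components lie in
`splittingMonoidAt K 2l q j = μ_{2l} · q^{j²·ℕ}` (p407350). [cite: Mochizuki2012, Cor 3.5 (ii) p.94] -/
theorem apply_mem_splittingMonoidAt {twoL : ℕ} {q : K} {lstar : ℕ} {ζ : Fin lstar → Kˣ}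
    (hζ : ∀ i, ζ i ∈ rootsOfUnity twoL K) {x : Fin lstar → K}
    (hx : x ∈ gaussianSplittingMonoid K twoL (valueProfileOf q (fun i => labelNat i ^ 2) ζ))
    (i : Fin lstar) : x i ∈ splittingMonoidAt K twoL q (labelNat i) :=
  apply_mem_OPerp_pow hζ hx i

/-- The `2l`-th power of the profile is torsion-free data: `ξ^{2l} = (q^{2l · e i})_i` for `ζ_i ∈ μ_{2l}` (the content
of "`Ψ_{2l·ξ}` is independent of `ξ`", Cor 3.5 (ii) p. 95, for profiles built from one `q`).
[cite: Mochizuki2012, Cor 3.5 (ii) p.95] -/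
theorem valueProfileOf_pow_twoL {twoL : ℕ} (q : K) (e : ι → ℕ) {ζ : ι → Kˣ}
    (hζ : ∀ i, ζ i ∈ rootsOfUnity twoL K) :
    valueProfileOf q e ζ ^ twoL = fun i => q ^ (twoL * e i) := by
  funext i
  have h := hζ i
  rw [mem_rootsOfUnity] at h
  rw [Pi.pow_apply, valueProfileOf_apply, mul_pow, ← Units.val_pow_eq_pow_val, h, Units.val_one, one_mul,
    ← pow_mul, mul_comm]

end Profile

end Literature.IUT.HodgeArakelov
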